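import Summits.BirchSwinnertonDyer.BirchSwinnertonDyer.Theses.GenusKolyvaginAtTwo
import Summits.BirchSwinnertonDyer.BirchSwinnertonDyer.Theses.ByReductionTypeAtTwo
import Summits.BirchSwinnertonDyer.BirchSwinnertonDyer.Theorems.GenusKolyvaginAtTwoMinimalTwinBSDTwoAllDepthCells
import Summits.BirchSwinnertonDyer.BirchSwinnertonDyer.Theorems.GenusKolyvaginAtTwoKolyvaginExclusionsOfHeegner
import HarnessLib

/-!
# Route `GenusKolyvaginAtTwo`, crux U₂ `MinimalTwinBSDTwo` (stmt-BirchSwinnertonDyer-22985), LINE 23 «twin_swap»: THE JETCHEV SPLIT OF THE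
# `Δ < 0` EXPONENT STUB — the DIVISIBILITY half of EXP⁻_all is the route's own crux `TamagawaDivisibilityAtTwo` (stmt-BirchSwinnertonDyer-27467,
# Jetchev 2008 Thm. 1.4 read at `p = 2`) at conductor `n = 1`; what is left is 2-PRIMITIVITY of `y_K` beyond the Tamagawa shift

Seat `bsd-line-gk2-p2` g28 (PROVER seat 2/3, cell `bsd-f1-sign2`; LINE 23 holder), `--supports stmt-BirchSwinnertonDyer-22985` (helper; closes
nothing).  THEOREMS ONLY (no definition, no named fact, no `sorry`); standard axioms.  **BSD is NOT proved by this file; U₂, the wall, the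
rank-zero 2-converse, item 27467 and the primitivity statement NDIV⁻ below are NOT proved; no item is closed.**  Every theorem is CONDITIONAL on
its displayed hypotheses.

THE POINT (planner / census currency).  On `Δ_W < 0` the lineage's depth-free cell engine (`AllDepth.bsdp_negDisc_of_wall_of_converse_of_exponent_of_facts`,
p776404) proves U₂ from S1 (rank-`0` `2`-Selmer-trivial wall) + CONV₀ (rank-`0` `2`-converse) + PRINT + ONE research stub EXP⁻_all = «at every door-open
prime Heegner frame, `2^e ∥ P(1)` with `e = ord₂ c + ord₂ C(W)`».  EXP⁻_all is a conjunction DIV ∧ NDIV.  This file observes that its DIV half —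
«`2^{ord₂ C(W)} ∣ P(1)` in `W(K[1])`» — is, on the slice

  𝒮 = { `N_W` odd, `ρ_{W,2^∞}` onto, the `2`-part of `C(W)` carried by ONE prime `q₀ ∣ N_W`, an odd-Manin optimal datum },

EXACTLY the `n = 1` instance of the route's crux `TamagawaDivisibilityAtTwo` (27467; LINE 9, «Jetchev 2008 Thm. 1.4 at `p = 2`», typed SIGN-FREE, so it
applies to the rank-ONE parametrised member of the swapped pair): §1.  Hence (§3) **U₂|𝒮 ∩ {Δ < 0} ⟸ S1 + CONV₀ + 27467 + NDIV⁻ + PRINT**, where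
NDIV⁻ = «`P(1) ∉ 2^{ord₂ C(W)+1} W(K[1])`» is the shifted 2-PRIMITIVITY of the Heegner point (the conductor-`1` case of the primitivity certificate of
the route's `ShiftedGenusSupplyAtTwo`, stmt-27467's sibling 27468, in the swapped frame) — the SAME K-input class (Kolyvagin non-vanishing mod `2^{t+1}`)
as the habitat side's K₁±/K₄±.  So LINE 9's crux 27467 has TRANSFER value: it carries the divisibility half of the rank-ONE member's `2`-adic
Gross–Zagier index relation on the even-Tamagawa `Δ < 0` cells, and U₂'s research content there is primitivity only.  §2 is the frame-level dictionary
(at a door-open `2`-Selmer-trivial frame the KEX-shaped relation of v2.2/v2.3 is produced from DIV ∧ NDIV, `#Ш(W_K)[2^∞] = 1` unconditionally).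

References: [GrossZagier1986] V.§2 (2.2)–(2.3); [Jetchev2008] Thm. 1.4, Cor. 1.5 (= doi:10.1112/S0010437X08003497, arXiv:math/0703431 p. 3);
[GrossLMS1991] §4 (P(1) = y_K), §5 Prop. 5.3; [McCallumLMS1991] §5 Lemma 5.1; [Kramer1981] Thm. 1, §2 Prop. 3; [MazurRubin2010] Prop. 3.3, Cor. 3.4 (i);
[Milne1972ArithmeticAV] §1 Thm. 1; [BCDTJAMS2001] Thm. A; [Miller2011LMS] Def. 1.1.
-/

set_option autoImplicit false
set_option linter.dupNamespace false -- `Summit.<P>.<Sub>` repeats `BirchSwinnertonDyer` (D-0017)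

noncomputable section

open scoped Classical

open WeierstrassCurve NumberField Literature.NumberTheory.EllipticCurves
  Literature.NumberTheory.EllipticCurves.ModularForms
  Literature.NumberTheory.EllipticCurves.Rank1Residual
  Literature.NumberTheory.QuadraticFields
  Summit.BirchSwinnertonDyer.Rank1Residual
  Summit.BirchSwinnertonDyer.Rank1Residual.AdditivePotMult
  Summit.BirchSwinnertonDyer.Rank1Residual.F1Sign2
  Summit.BirchSwinnertonDyer.BirchSwinnertonDyer.Rank1Residual
  Summit.BirchSwinnertonDyer.BirchSwinnertonDyer.Theorems
  Summit.BirchSwinnertonDyer.BirchSwinnertonDyer.Theorems.GenusExact.TwinSwap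
open Summit.BirchSwinnertonDyer.BirchSwinnertonDyer.Theses.GenusKolyvaginAtTwo

open Summit.BirchSwinnertonDyer.BirchSwinnertonDyer.Theses.ByReductionTypeAtTwo
  (GoodOrdinaryRankZeroAtTwo MultiplicativeRankZeroAtTwo SupersingularRankZeroAtTwo AdditiveRankZeroAtTwo)
open Summit.BirchSwinnertonDyer.BirchSwinnertonDyer.Theses.TwoAdicConverse (GoodOrdinaryRankZeroTwoConverse MultiplicativeRankZeroTwoConverse)
open Summit.BirchSwinnertonDyer.BirchSwinnertonDyer.Theorems.GenusExact.TwinSwap.Ledger.Line25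
  (entireLFunction_twist_one_ne_zero_of_rankZeroTwoConverse_of_natCard_selmerGroup_eq_one
    not_isOfFinAddOrder_derivedPoint_one_of_rankOne_of_lValue_ne_zero rankZeroTwoConverse_of_items_of_offSemistable)
open Summit.BirchSwinnertonDyer.BirchSwinnertonDyer.Theorems.GenusExact.TwinSwap.OneBit
  (swappedPairDescentAtTwo_tamagawaDepth_of_facts natCard_primaryComponent_sha_baseChange_two_eq_one_of_swappedPair_of_le_succ)
open Summit.BirchSwinnertonDyer.BirchSwinnertonDyer.Theorems.GenusExact.TwinSwap.DoorOpen
  (exists_doorOpen_prime_heegnerField_selmerTrivialTwin hasSurjectiveModNGaloisRep_two_of_negDisc_of_natCard_selmerGroup_eq_two)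
open Summit.BirchSwinnertonDyer.BirchSwinnertonDyer.Theorems.GenusExact
  (not_isSquare_discr_mul_neg_abs_Δ_of_odd not_isSquare_discr_mul_neg_two_mul_abs_Δ_of_odd)

namespace Summit.BirchSwinnertonDyer.BirchSwinnertonDyer.Theorems.GenusExact.TwinSwap.JetchevSplit

/-! ## §1 DIV at conductor `1` is item 27467 at `n = 1` -/

/-- **`2^s ∣ y_K` FOR EVERY `s ≤ ord₂ c_q`, FROM ITEM 27467 AT CONDUCTOR `1`.**  `TamagawaDivisibilityAtTwo` (stmt-BirchSwinnertonDyer-27467, Jetchev 2008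
Thm. 1.4 read at `p = 2`; sign-free as typed) on its own frame — `W/ℚ` globally minimal non-CM, `Δ_W < 0`, `K` imaginary quadratic with `d_K ≠ −3, −4`,
Heegner for `N_W`, `N_W` odd, Kolyvagin's two exclusions, `ρ_{W,2^∞}` onto, an optimal datum — applied to the conductor-`1` datum `d₁` itself
(`n = 1` is square-free with no prime factor, so the Kolyvagin-prime clause is vacuous): for every prime `q ∣ N_W` and every
`s ≤ ord₂ c_q(W)`, **`P(1) = y_K ∈ 2^s W(K[1])`**.  CONDITIONAL on `hJ` (an OPEN route crux); proves nothing by itself.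
[cite: Jetchev2008, Thm. 1.4 (m_∞ ≥ m_max; n = 1: p^{ord_p c_q} ∣ y_K)] [cite: GrossLMS1991, §4 (P_1 = y_K)] -/
theorem twoPow_dvd_derivedPoint_one_of_tamagawaDivisibilityAtTwo (hJ : TamagawaDivisibilityAtTwo)
    (W : WeierstrassCurve ℚ) [W.IsElliptic] [W.IsGloballyMinimal] [NeZero (W.conductorNorm ℤ)]
    (hcm : ¬ W.HasCM) (hΔ : W.Δ < 0) (K : Type) [Field K] [NumberField K] (hK : IsImaginaryQuadratic K)
    (h3 : NumberField.discr K ≠ -3) (h4 : NumberField.discr K ≠ -4) (hH : SatisfiesHeegnerHypothesis (W.conductorNorm ℤ) K)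
    (hN : ¬ 2 ∣ W.conductorNorm ℤ)
    (hsq1 : ¬ IsSquare ((NumberField.discr K : ℚ) * -|W.Δ|)) (hsq2 : ¬ IsSquare ((NumberField.discr K : ℚ) * (-(2 * |W.Δ|))))
    (hρ : ∀ n : ℕ, 0 < n → W.HasSurjectiveModNGaloisRep ((2 : ℤ) ^ n))
    (hopt : ∃ Dt₀ : ModularParametrizationData W (W.conductorNorm ℤ),
      ∀ z ∈ Dt₀.L.lattice, ∃ w ∈ periodLattice Dt₀.f, z = (Dt₀.c : ℂ) * w)
    (Dt : ModularParametrizationData W (W.conductorNorm ℤ)) (β : ℤ) (ι : K →+* ℂ) (d₁ : KolyvaginHeegnerData Dt β ι 1)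
    (hy : ¬ IsOfFinAddOrder d₁.derivedPoint)
    (q : ℕ) [Fact q.Prime] (hq : (q : ℤ) ∣ W.conductorNorm ℤ)
    (s : ℕ) (hs : s ≤ padicValNat 2 ((W.baseChange ℚ_[q]).localTamagawaNumber ℤ_[q])) :
    ∃ Q : (W.baseChange (ringClassField K ι 1)).toAffine.Point, ((2 ^ s : ℕ) : ℤ) • Q = d₁.derivedPoint :=
  hJ W hcm hΔ K hK h3 h4 hH hN hsq1 hsq2 hρ hopt Dt β ι d₁ hy q hq s hs 1 d₁ squarefree_one
    (fun ℓ hℓ ↦ absurd hℓ (by rw [Nat.primeFactors_one]; exact Finset.notMem_empty ℓ))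

/-- **DIV ON THE CONCENTRATED SLICE: `2^{ord₂ C(W)} ∣ y_K` FROM ITEM 27467.**  Same frame; if the `2`-part of the Tamagawa product is carried by ONE
prime `q₀ ∣ N_W` (`ord₂ c_{q₀} = ord₂ C(W)`, the binder shape of the route's `ShiftedGenusSupplyAtTwo`), then `P(1) ∈ 2^{ord₂ C(W)} W(K[1])`.  On a
Heegner field with ODD `d_K` the two exclusions and `d_K ≠ −4` are automatic (`GenusExact.not_isSquare_discr_mul_neg_abs_Δ_of_odd` /
`…_neg_two_mul_abs_Δ_of_odd`, this lineage g7), so they are discharged here.  CONDITIONAL on `hJ`.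
[cite: Jetchev2008, Thm. 1.4, Cor. 1.5] [cite: Kolyvagin1989Izv, Thm. B (the field exclusions)] -/
theorem twoPow_tamagawa_dvd_derivedPoint_one_of_tamagawaDivisibilityAtTwo (hJ : TamagawaDivisibilityAtTwo)
    (W : WeierstrassCurve ℚ) [W.IsElliptic] [W.IsGloballyMinimal] [NeZero (W.conductorNorm ℤ)]
    (hcm : ¬ W.HasCM) (hΔ : W.Δ < 0) (K : Type) [Field K] [NumberField K] (hK : IsImaginaryQuadratic K)
    (hodd : Odd (NumberField.discr K)) (h3 : NumberField.discr K ≠ -3) (hH : SatisfiesHeegnerHypothesis (W.conductorNorm ℤ) K)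
    (hN : ¬ 2 ∣ W.conductorNorm ℤ)
    (hρ : ∀ n : ℕ, 0 < n → W.HasSurjectiveModNGaloisRep ((2 : ℤ) ^ n))
    (hopt : ∃ Dt₀ : ModularParametrizationData W (W.conductorNorm ℤ),
      ∀ z ∈ Dt₀.L.lattice, ∃ w ∈ periodLattice Dt₀.f, z = (Dt₀.c : ℂ) * w)
    (hq₀ : ∃ (q₀ : ℕ) (_ : Fact q₀.Prime), (q₀ : ℤ) ∣ W.conductorNorm ℤ ∧
      padicValNat 2 ((W.baseChange ℚ_[q₀]).localTamagawaNumber ℤ_[q₀]) = padicValNat 2 W.tamagawaProduct)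
    (Dt : ModularParametrizationData W (W.conductorNorm ℤ)) (β : ℤ) (ι : K →+* ℂ) (d₁ : KolyvaginHeegnerData Dt β ι 1)
    (hy : ¬ IsOfFinAddOrder d₁.derivedPoint) :
    ∃ Q : (W.baseChange (ringClassField K ι 1)).toAffine.Point,
      ((2 ^ padicValNat 2 W.tamagawaProduct : ℕ) : ℤ) • Q = d₁.derivedPoint := by
  obtain ⟨q₀, hq₀F, hq₀, hconc⟩ := hq₀
  have h4 : NumberField.discr K ≠ -4 := fun h ↦ by
    rw [h] at hodd
    exact (Int.not_even_iff_odd.mpr hodd) ⟨-2, by norm_num⟩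
  rw [← hconc]
  exact twoPow_dvd_derivedPoint_one_of_tamagawaDivisibilityAtTwo hJ W hcm hΔ K hK h3 h4 hH hN
    (not_isSquare_discr_mul_neg_abs_Δ_of_odd W hK hodd hH) (not_isSquare_discr_mul_neg_two_mul_abs_Δ_of_odd W hK hodd hH)
    hρ hopt Dt β ι d₁ hy q₀ hq₀ _ le_rfl

/-! ## §2 The frame-level dictionary: DIV ∧ NDIV give the KEX-shaped relation at a door-open `2`-Selmer-trivial frame -/

/-- **AT A ONE-BIT FRAME, DIV ∧ NDIV IS THE KEX-SHAPED RELATION** (converse of the lineage's `Uniform.twoDepth_eq_of_kex_of_le_succ`).  `W/ℚ` globally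
minimal, `Δ_W < 0`, rank `≥ 1`, `#Sel₂(W) = 2`; `K` imaginary quadratic, `d_K` odd, Heegner; `Wd = Cd • W^{(d_K)}` elliptic with `#Sel₂(Wd) = 1`
inside the one-bit budget `ord₂ C(Wd) ≤ ord₂ C(W) + 1`.  Then `#Ш(W_K)[2^∞] = 1` UNCONDITIONALLY (`OneBit.natCard_primaryComponent_sha_…_of_le_succ`,
Kramer), so for ANY point `P` of ANY group and ANY `e`: `2^e ∥ P` gives `∃ M₀, 2^{M₀} ∥ P ∧ #Ш(W_K)[2^∞] · 2^{2e} = 2^{2M₀}` (with `M₀ = e`).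
[cite: Kramer1981, Thm. 1, §2 Prop. 3] [cite: GrossZagier1986, V.§2 (2.2)] -/
theorem kex_of_twoDepth_of_le_succ (W : WeierstrassCurve ℚ) [W.IsElliptic] [W.IsGloballyMinimal]
    (K : Type) [Field K] [NumberField K]
    (hΔ : W.Δ < 0) (hIQ : IsImaginaryQuadratic K) (hodd : Odd (NumberField.discr K))
    (hHe : SatisfiesHeegnerHypothesis (W.conductorNorm ℤ) K)
    (hrk : 1 ≤ W.mordellWeilRank) (hSel : Nat.card (W.selmerGroup 2) = 2)
    {Wd : WeierstrassCurve ℚ} [Wd.IsElliptic] (Cd : VariableChange ℚ) (hWd : Cd • W.quadraticTwist (NumberField.discr K : ℚ) = Wd)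
    (hSel1 : Nat.card (Wd.selmerGroup 2) = 1)
    (hDEF : padicValNat 2 Wd.tamagawaProduct ≤ padicValNat 2 W.tamagawaProduct + 1)
    {A : Type*} [AddCommGroup A] (P : A) (e : ℕ)
    (hdiv : ∃ Q : A, ((2 ^ e : ℕ) : ℤ) • Q = P) (hndiv : ¬ ∃ Q : A, ((2 ^ (e + 1) : ℕ) : ℤ) • Q = P) :
    ∃ M₀ : ℕ, (∃ Q : A, ((2 ^ M₀ : ℕ) : ℤ) • Q = P) ∧ (¬ ∃ Q : A, ((2 ^ (M₀ + 1) : ℕ) : ℤ) • Q = P) ∧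
      Nat.card (AddCommGroup.primaryComponent (W.baseChange K).sha 2) * 2 ^ (2 * e) = 2 ^ (2 * M₀) :=
  ⟨e, hdiv, hndiv, by
    rw [(natCard_primaryComponent_sha_baseChange_two_eq_one_of_swappedPair_of_le_succ W K hΔ hIQ hodd hHe hrk hSel Cd hWd hSel1 hDEF).2,
      one_mul]⟩

/-- **EXP⁻ AT A FRAME OF THE SLICE ⟸ 27467 ∧ NDIV⁻.**  On item 27467's frame (`W/ℚ` globally minimal non-CM, `Δ_W < 0`, `N_W` odd, `ρ_{W,2^∞}` onto,
an optimal datum; `K` imaginary quadratic, `d_K` odd `≠ −3`, Heegner), with the `2`-part of `C(W)` carried by one prime `q₀ ∣ N_W`, for a datum `Dt`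
with ODD Manin constant and `P(1)` of infinite order: `TamagawaDivisibilityAtTwo` gives DIV (`2^{ord₂ c + ord₂ C(W)} ∣ P(1)`, `ord₂ c = 0`), so the
exponent clause of EXP⁻_all («`2^{ord₂ c + ord₂ C(W)} ∥ P(1)`», binder `hEXPneg` of `AllDepth.bsdp_negDisc_…`, text verbatim) follows from NDIV⁻ alone:
«`P(1) ∉ 2^{ord₂ c + ord₂ C(W) + 1} W(K[1])`».  CONDITIONAL on `hJ`; proves nothing about BSD.
[cite: Jetchev2008, Thm. 1.4] [cite: GrossLMS1991, §4, §5 Prop. 5.3] -/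
theorem expNeg_of_tamagawaDivisibilityAtTwo_of_ndiv (hJ : TamagawaDivisibilityAtTwo)
    (W : WeierstrassCurve ℚ) [W.IsElliptic] [W.IsGloballyMinimal] [NeZero (W.conductorNorm ℤ)]
    (hcm : ¬ W.HasCM) (hΔ : W.Δ < 0) (K : Type) [Field K] [NumberField K] (hK : IsImaginaryQuadratic K)
    (hodd : Odd (NumberField.discr K)) (h3 : NumberField.discr K ≠ -3) (hH : SatisfiesHeegnerHypothesis (W.conductorNorm ℤ) K)
    (hN : ¬ 2 ∣ W.conductorNorm ℤ)
    (hρ : ∀ n : ℕ, 0 < n → W.HasSurjectiveModNGaloisRep ((2 : ℤ) ^ n))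
    (hopt : ∃ Dt₀ : ModularParametrizationData W (W.conductorNorm ℤ),
      ∀ z ∈ Dt₀.L.lattice, ∃ w ∈ periodLattice Dt₀.f, z = (Dt₀.c : ℂ) * w)
    (hq₀ : ∃ (q₀ : ℕ) (_ : Fact q₀.Prime), (q₀ : ℤ) ∣ W.conductorNorm ℤ ∧
      padicValNat 2 ((W.baseChange ℚ_[q₀]).localTamagawaNumber ℤ_[q₀]) = padicValNat 2 W.tamagawaProduct)
    (Dt : ModularParametrizationData W (W.conductorNorm ℤ)) (hc : Odd Dt.c) (β : ℤ) (ι : K →+* ℂ)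
    (d₁ : KolyvaginHeegnerData Dt β ι 1) (hy : ¬ IsOfFinAddOrder d₁.derivedPoint)
    (hndiv : ¬ ∃ Q : (W.baseChange (ringClassField K ι 1)).toAffine.Point,
      ((2 ^ (padicValInt 2 Dt.c + padicValNat 2 W.tamagawaProduct + 1) : ℕ) : ℤ) • Q = d₁.derivedPoint) :
    (∃ Q : (W.baseChange (ringClassField K ι 1)).toAffine.Point,
        ((2 ^ (padicValInt 2 Dt.c + padicValNat 2 W.tamagawaProduct) : ℕ) : ℤ) • Q = d₁.derivedPoint) ∧
      (¬ ∃ Q : (W.baseChange (ringClassField K ι 1)).toAffine.Point,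
        ((2 ^ (padicValInt 2 Dt.c + padicValNat 2 W.tamagawaProduct + 1) : ℕ) : ℤ) • Q = d₁.derivedPoint) := by
  refine ⟨?_, hndiv⟩
  -- the exponent of an odd-Manin datum: `ord₂ c = 0` (as in `GoldfeldGoodTwists.padicValInt_two_of_odd`)
  have hc2 : padicValInt 2 Dt.c = 0 :=
    padicValInt.eq_zero_of_not_dvd fun h ↦ (Int.not_even_iff_odd.mpr hc) (even_iff_two_dvd.mpr (by exact_mod_cast h))
  rw [hc2, zero_add]
  exact twoPow_tamagawa_dvd_derivedPoint_one_of_tamagawaDivisibilityAtTwo hJ W hcm hΔ K hK hodd h3 hH hN hρ hopt hq₀ Dt β ι d₁ hy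

/-! ## §3 The cell theorem: U₂ on the slice from the wall, the converse, item 27467 and shifted primitivity -/

/-- ★ **U₂ ON THE `Δ < 0` SLICE 𝒮, FROM THE WALL, THE RANK-ZERO 2-CONVERSE, JETCHEV AT 2 (ITEM 27467) AND SHIFTED 2-PRIMITIVITY OF `y_K`.**
Hypotheses: PRINT (`hGZ` Gross–Zagier at every level, `hGZK` Gross–Zagier–Kolyvagin, `hmod` modularity, `hMilneC` Milne 1972 any model); `hS1` = S1
(BSD₂ for non-CM rank-`0` curves with `#Sel₂ = 1` — WALL row 1 by reduction type); `hC0` = CONV₀ (the rank-zero `2`-converse on all non-CM globally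
minimal curves = items 19218 + 19219 + the off-semistable residual); `hJ` = item 27467 `TamagawaDivisibilityAtTwo` BY NAME; `hNDIV` = NDIV⁻: for `W`
non-CM, `r_an = 1`, `#Sel₂ = 2`, `Δ < 0`, `N_W` odd, `ρ_{W,2^∞}` onto, the `2`-part of `C(W)` at one prime, at EVERY door-open prime Heegner field
`K = ℚ(√−ℓ)` (`d_K = −ℓ` odd `≠ −3`, Heegner, `2` split, a class of `Sel₂(W)` alive at `ℓ`) with `L(W^{(d_K)},1) ≠ 0`, EVERY optimal datum with ODD
Manin constant and EVERY conductor-`1` datum on it: **`P(1) ∉ 2^{ord₂ C(W) + 1} W(K[1])`**.  CONCLUSION: `BSD₂(W)` for every non-CM globally minimal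
`W` with `r_an = 1`, `#Sel₂(W) = 2`, `Δ_W < 0`, `N_W` odd, `ρ_{W,2^∞}` onto, an optimal odd-Manin datum, and `ord₂ c_{q₀} = ord₂ C(W)` for some prime
`q₀ ∣ N_W`.  Proof: rank `1` (GZK) ⟹ `ρ̄_{W,2}` onto on `Δ < 0`; the door-open prime Heegner field with a globally minimal `2`-Selmer-trivial twin
costing one bit (p775020, unconditional); `L(W^{(d_K)},1) ≠ 0` by CONV₀, so `r_an(Wd) = 0` and `BSD₂(Wd)` by S1; the conductor-`1` datum ON THE
ODD-MANIN OPTIMAL DATUM (Darmon Thm. 3.6 at conductor `1`, PROVED in the tree) with `P(1)` of infinite order (Gross–Zagier); DIV by §1 (item 27467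
at `n = 1`), NDIV by `hNDIV`; then `OneBit.swappedPairDescentAtTwo_tamagawaDepth_of_facts`.  CONDITIONAL on the displayed hypotheses (two of them
OPEN route items); proves nothing about BSD; closes nothing.
[cite: Jetchev2008, Thm. 1.4, Cor. 1.5] [cite: GrossZagier1986, I.(6.3), V.§2 (2.2)] [cite: MazurRubin2010, Prop. 3.3, Cor. 3.4 (i), Lemma 3.5]
[cite: Darmon2004, Thm. 3.6] [cite: McCallumLMS1991, §5 Lemma 5.1] [cite: Milne1972ArithmeticAV, §1 Thm. 1] [cite: Miller2011LMS, Def. 1.1] -/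
theorem bsdp_negDisc_of_wall_of_converse_of_tamagawaDivisibility_of_ndiv_of_facts
    (hGZ : ∀ (N : ℕ) [NeZero N] (W : WeierstrassCurve ℚ) (K : Type) [Field K] [NumberField K], gross_zagier N W K)
    (hGZK : rank_eq_analyticRank_of_analyticRank_le_one) (hmod : hasEntireLFunction_rat)
    (hMilneC : Milne1972.bsdQuotient_baseChange_quadratic_anyModel)
    (hS1 : ∀ (W : WeierstrassCurve ℚ) [W.IsElliptic] [W.IsGloballyMinimal],
      ¬ W.HasCM → W.analyticRank = 0 → Nat.card (W.selmerGroup 2) = 1 → BSDp W 2)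
    (hC0 : ∀ (V : WeierstrassCurve ℚ) [V.IsElliptic] [V.IsGloballyMinimal], ¬ V.HasCM → V.selmerCorank 2 = 0 → V.analyticRank = 0)
    (hJ : TamagawaDivisibilityAtTwo)
    (hNDIV : ∀ (W : WeierstrassCurve ℚ) [W.IsElliptic] [W.IsGloballyMinimal] [NeZero (W.conductorNorm ℤ)],
      ¬ W.HasCM → W.analyticRank = 1 → Nat.card (W.selmerGroup 2) = 2 → W.Δ < 0 → ¬ 2 ∣ W.conductorNorm ℤ →
      (∀ n : ℕ, 0 < n → W.HasSurjectiveModNGaloisRep ((2 : ℤ) ^ n)) →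
      (∃ (q₀ : ℕ) (_ : Fact q₀.Prime), (q₀ : ℤ) ∣ W.conductorNorm ℤ ∧
        padicValNat 2 ((W.baseChange ℚ_[q₀]).localTamagawaNumber ℤ_[q₀]) = padicValNat 2 W.tamagawaProduct) →
      ∀ (K : Type) [Field K] [NumberField K], IsImaginaryQuadratic K →
        ∀ (ℓ : ℕ) [Fact ℓ.Prime], NumberField.discr K = -(ℓ : ℤ) → ¬ W.selmerGroup 2 ≤ MazurRubin2010.strictLocalKer W ℚ_[ℓ] 2 →
        Odd (NumberField.discr K) → NumberField.discr K ≠ -3 → SatisfiesHeegnerHypothesis (W.conductorNorm ℤ) K →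
        ((Ideal.span {(2 : ℤ)}).primesOver (𝓞 K)).ncard = 2 →
        (W.quadraticTwist (NumberField.discr K : ℚ)).entireLFunction 1 ≠ 0 →
        ∀ (Dt : ModularParametrizationData W (W.conductorNorm ℤ)),
          (∀ z ∈ Dt.L.lattice, ∃ w ∈ periodLattice Dt.f, z = (Dt.c : ℂ) * w) → Odd Dt.c →
        ∀ (β : ℤ) (ι : K →+* ℂ) (d₁ : KolyvaginHeegnerData Dt β ι 1),
          ¬ ∃ Q : (W.baseChange (ringClassField K ι 1)).toAffine.Point,
            ((2 ^ (padicValNat 2 W.tamagawaProduct + 1) : ℕ) : ℤ) • Q = d₁.derivedPoint) :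
    ∀ (W : WeierstrassCurve ℚ) [W.IsElliptic] [W.IsGloballyMinimal] [NeZero (W.conductorNorm ℤ)], ¬ W.HasCM → W.analyticRank = 1 →
      Nat.card (W.selmerGroup 2) = 2 → W.Δ < 0 → ¬ 2 ∣ W.conductorNorm ℤ →
      (∀ n : ℕ, 0 < n → W.HasSurjectiveModNGaloisRep ((2 : ℤ) ^ n)) →
      (∃ Dt : ModularParametrizationData W (W.conductorNorm ℤ),
        (∀ z ∈ Dt.L.lattice, ∃ w ∈ periodLattice Dt.f, z = (Dt.c : ℂ) * w) ∧ Odd Dt.c) →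
      (∃ (q₀ : ℕ) (_ : Fact q₀.Prime), (q₀ : ℤ) ∣ W.conductorNorm ℤ ∧
        padicValNat 2 ((W.baseChange ℚ_[q₀]).localTamagawaNumber ℤ_[q₀]) = padicValNat 2 W.tamagawaProduct) →
      BSDp W 2 := by
  intro W _ _ _ hcm hr hSel hΔ hN hρ hopt hq₀
  -- rank one (GZK), so `ρ̄_{W,2}` is onto on `Δ < 0`
  have hrk : W.mordellWeilRank = 1 := by rw [(hGZK W (le_of_eq hr)).1, hr]
  have hsurj : W.HasSurjectiveModNGaloisRep 2 :=
    hasSurjectiveModNGaloisRep_two_of_negDisc_of_natCard_selmerGroup_eq_two W hΔ hSel hrk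
  -- the door-open prime Heegner field with its globally minimal Sel₂-trivial twin costing exactly one bit (unconditional)
  obtain ⟨ℓ, hℓF, -, -, -, hns, K, _, _, hK, hd, hodd, h3, hH, h2K, -, -, Wd, _, _, ⟨Cd, hCd⟩, hSel1, hTam⟩ :=
    exists_doorOpen_prime_heegnerField_selmerTrivialTwin W hΔ hsurj hSel 0
  haveI := hℓF
  have hD0 : (NumberField.discr K : ℚ) ≠ 0 := by exact_mod_cast NumberField.discr_ne_zero K
  haveI := W.isElliptic_quadraticTwist hD0
  -- the central value through the rank-zero 2-converse
  have hL : (W.quadraticTwist (NumberField.discr K : ℚ)).entireLFunction 1 ≠ 0 :=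
    entireLFunction_twist_one_ne_zero_of_rankZeroTwoConverse_of_natCard_selmerGroup_eq_one hC0 hmod W hcm hD0 Wd hCd hSel1
  -- the conductor-1 datum ON THE ODD-MANIN OPTIMAL DATUM (Darmon Thm. 3.6 at conductor 1, proved), its Heegner point of infinite order
  obtain ⟨Dt, hlat, hc⟩ := hopt
  obtain ⟨β, hβ⟩ : ∃ β : ℤ, (4 * (W.conductorNorm ℤ : ℕ) : ℤ) ∣ β ^ 2 - NumberField.discr K :=
    Quadratic.exists_dvd_sq_sub_discr_of_ncard_primesOver hK.1 (NeZero.ne _) hH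
  obtain ⟨ι⟩ : Nonempty (K →+* ℂ) := inferInstance
  obtain ⟨d₁⟩ := exists_kolyvaginHeegnerData_one (phi_heegnerTau_mem_singularModuliField_holds (W.conductorNorm ℤ) W K) hK Dt β ι hβ
  have hc0 : Dt.c ≠ 0 := fun h ↦ Dt.cast_c_ne_zero (by rw [h, Int.cast_zero])
  have hy : ¬ IsOfFinAddOrder d₁.derivedPoint :=
    not_isOfFinAddOrder_derivedPoint_one_of_rankOne_of_lValue_ne_zero hmod W K (hGZ _ W K) hK hH hr hL d₁
  -- DIV from item 27467 at `n = 1`, NDIV from `hNDIV`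
  have hndiv : ¬ ∃ Q : (W.baseChange (ringClassField K ι 1)).toAffine.Point,
      ((2 ^ (padicValInt 2 Dt.c + padicValNat 2 W.tamagawaProduct + 1) : ℕ) : ℤ) • Q = d₁.derivedPoint := by
    have hc2 : padicValInt 2 Dt.c = 0 :=
      padicValInt.eq_zero_of_not_dvd fun h ↦ (Int.not_even_iff_odd.mpr hc) (even_iff_two_dvd.mpr (by exact_mod_cast h))
    rw [hc2, zero_add]
    exact hNDIV W hcm hr hSel hΔ hN hρ hq₀ K hK ℓ hd hns hodd h3 hH h2K hL Dt hlat hc β ι d₁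
  obtain ⟨hdiv, -⟩ := expNeg_of_tamagawaDivisibilityAtTwo_of_ndiv hJ W hcm hΔ K hK hodd h3 hH hN hρ ⟨Dt, hlat⟩ hq₀ Dt hc β ι d₁ hy hndiv
  -- the twin is non-CM of analytic rank 0: `BSD₂(Wd)` from the wall
  have hcmd : ¬ Wd.HasCM := by
    rw [← hCd, hasCM_iff_of_j_eq (((W.quadraticTwist (NumberField.discr K : ℚ)).variableChange_j Cd).trans (W.j_quadraticTwist hD0))]
    exact hcm
  have hrd : Wd.analyticRank = 0 := by
    rw [← hCd, analyticRank_smul]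
    exact ((W.quadraticTwist (NumberField.discr K : ℚ)).analyticRank_eq_zero_iff_holds (hmod _)).mpr hL
  have hBd : BSDp Wd 2 := hS1 Wd hcmd hrd hSel1
  exact swappedPairDescentAtTwo_tamagawaDepth_of_facts hGZ hGZK hmod hMilneC W hr hSel hΔ K hK hodd h3 hH Dt hc0 β ι d₁ hy hdiv hndiv
    Wd ⟨Cd, hCd⟩ hSel1 hTam.le hBd

/-! ## §4 The item ledger of the slice: route items BY NAME + NDIV⁻ -/

/-- ★ **THE ITEM LEDGER OF THE SLICE (BY NAME).**  With the route's items as hypotheses — WALL row 1 `GoodOrdinaryRankZeroAtTwo` (stmt-19095),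
`MultiplicativeRankZeroAtTwo`, `SupersingularRankZeroAtTwo`, `AdditiveRankZeroAtTwo` (route ByReductionTypeAtTwo); the rank-zero `2`-converse items
`GoodOrdinaryRankZeroTwoConverse` (stmt-19218), `MultiplicativeRankZeroTwoConverse` (stmt-19219) (route TwoAdicConverse) and its declared
off-semistable residual (text of `RankZeroTwoConverseOffSemistableAtTwo` with `r = 0`); **`TamagawaDivisibilityAtTwo` (stmt-27467, THIS route)**;
the four print items `GrossZagierAllLevels` (24148), `MultPublishedInputsAtTwo` (19921), `EntireLFunctionRat` (19273), `MilneAnyModel` (24149) —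
plus the ONE research statement NDIV⁻ (shifted `2`-primitivity of `y_K` at door-open prime frames, text of §3): **U₂ holds on the slice**
{`Δ_W < 0`, `N_W` odd, `ρ_{W,2^∞}` onto, an odd-Manin optimal datum, the `2`-part of `C(W)` at one prime}.  So on that slice of U₂ the crux's only
input beyond EXISTING items is NDIV⁻.  CONDITIONAL; proves nothing about BSD; closes nothing.
[cite: Jetchev2008, Thm. 1.4] [cite: GrossZagier1986, V.§2 (2.2)] [cite: Milne1972ArithmeticAV, §1 Thm. 1] -/
theorem bsdp_negDisc_slice_of_items_of_ndiv
    (hOrd : GoodOrdinaryRankZeroAtTwo) (hMult : MultiplicativeRankZeroAtTwo) (hSS : SupersingularRankZeroAtTwo) (hAdd : AdditiveRankZeroAtTwo)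
    (hC0g : GoodOrdinaryRankZeroTwoConverse) (hC0m : MultiplicativeRankZeroTwoConverse)
    (hC0r : ∀ (V : WeierstrassCurve ℚ) [V.IsElliptic] [V.IsGloballyMinimal], ¬ V.HasCM → ¬ (GoodOrd V 2 ∨ Mult V 2) →
      V.selmerCorank 2 = 0 → V.analyticRank = 0)
    (hJ : TamagawaDivisibilityAtTwo)
    (hGZ : GrossZagierAllLevels) (hGZK : MultPublishedInputsAtTwo) (hL : EntireLFunctionRat) (hMi : MilneAnyModel)
    (hNDIV : ∀ (W : WeierstrassCurve ℚ) [W.IsElliptic] [W.IsGloballyMinimal] [NeZero (W.conductorNorm ℤ)],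
      ¬ W.HasCM → W.analyticRank = 1 → Nat.card (W.selmerGroup 2) = 2 → W.Δ < 0 → ¬ 2 ∣ W.conductorNorm ℤ →
      (∀ n : ℕ, 0 < n → W.HasSurjectiveModNGaloisRep ((2 : ℤ) ^ n)) →
      (∃ (q₀ : ℕ) (_ : Fact q₀.Prime), (q₀ : ℤ) ∣ W.conductorNorm ℤ ∧
        padicValNat 2 ((W.baseChange ℚ_[q₀]).localTamagawaNumber ℤ_[q₀]) = padicValNat 2 W.tamagawaProduct) →
      ∀ (K : Type) [Field K] [NumberField K], IsImaginaryQuadratic K →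
        ∀ (ℓ : ℕ) [Fact ℓ.Prime], NumberField.discr K = -(ℓ : ℤ) → ¬ W.selmerGroup 2 ≤ MazurRubin2010.strictLocalKer W ℚ_[ℓ] 2 →
        Odd (NumberField.discr K) → NumberField.discr K ≠ -3 → SatisfiesHeegnerHypothesis (W.conductorNorm ℤ) K →
        ((Ideal.span {(2 : ℤ)}).primesOver (𝓞 K)).ncard = 2 →
        (W.quadraticTwist (NumberField.discr K : ℚ)).entireLFunction 1 ≠ 0 →
        ∀ (Dt : ModularParametrizationData W (W.conductorNorm ℤ)),
          (∀ z ∈ Dt.L.lattice, ∃ w ∈ periodLattice Dt.f, z = (Dt.c : ℂ) * w) → Odd Dt.c →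
        ∀ (β : ℤ) (ι : K →+* ℂ) (d₁ : KolyvaginHeegnerData Dt β ι 1),
          ¬ ∃ Q : (W.baseChange (ringClassField K ι 1)).toAffine.Point,
            ((2 ^ (padicValNat 2 W.tamagawaProduct + 1) : ℕ) : ℤ) • Q = d₁.derivedPoint) :
    ∀ (W : WeierstrassCurve ℚ) [W.IsElliptic] [W.IsGloballyMinimal] [NeZero (W.conductorNorm ℤ)], ¬ W.HasCM → W.analyticRank = 1 →
      Nat.card (W.selmerGroup 2) = 2 → W.Δ < 0 → ¬ 2 ∣ W.conductorNorm ℤ →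
      (∀ n : ℕ, 0 < n → W.HasSurjectiveModNGaloisRep ((2 : ℤ) ^ n)) →
      (∃ Dt : ModularParametrizationData W (W.conductorNorm ℤ),
        (∀ z ∈ Dt.L.lattice, ∃ w ∈ periodLattice Dt.f, z = (Dt.c : ℂ) * w) ∧ Odd Dt.c) →
      (∃ (q₀ : ℕ) (_ : Fact q₀.Prime), (q₀ : ℤ) ∣ W.conductorNorm ℤ ∧
        padicValNat 2 ((W.baseChange ℚ_[q₀]).localTamagawaNumber ℤ_[q₀]) = padicValNat 2 W.tamagawaProduct) →
      BSDp W 2 :=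
  bsdp_negDisc_of_wall_of_converse_of_tamagawaDivisibility_of_ndiv_of_facts hGZ hGZK hL hMi
    (fun W _ _ hCM hr _ ↦ by
      -- S1 from WALL row 1 by the reduction-type tetrachotomy at `2` (as in `AllDepth.minimalRankZeroBSDTwo_of_wallItems`)
      by_cases hg : W.HasGoodReductionAtPrime 2
      · by_cases hd : ((2 : ℕ) : ℤ) ∣ W.frobeniusTrace 2
        · exact hSS W hCM hr ⟨hg, hd⟩
        · exact hOrd W hCM hr ⟨hg, hd⟩
      · by_cases hm : W.HasMultiplicativeReductionAtPrime 2
        · exact hMult W hCM hr hm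
        · exact hAdd W hCM hr ⟨hg, hm⟩)
    (rankZeroTwoConverse_of_items_of_offSemistable hC0g hC0m hC0r) hJ hNDIV

/-! ## §5 (appended, same seat) The odd-Manin clause is PRINT on the slice: Abbes–Ullmo at `p = 2`, `N` odd -/

/-- **On `N_W` odd the optimal datum HAS odd Manin constant (Abbes–Ullmo 1996, Thm. A, the named Literature fact
`abbesUllmo_not_dvd_maninConstant_of_not_dvd_level`, read at `p = 2`)**, so §3's conclusion needs only «`W` carries an optimal datum»: U₂ on
{`r_an = 1`, `#Sel₂ = 2`, `Δ_W < 0`, `N_W` odd, `ρ_{W,2^∞}` onto, ∃ optimal datum, `ord₂ c_{q₀} = ord₂ C(W)`} ⟸ S1 + CONV₀ + 27467 + NDIV⁻ + PRINT + Abbes–Ullmo.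
CONDITIONAL on the displayed hypotheses (Abbes–Ullmo is a statement-only named fact); proves nothing about BSD; closes nothing.
[cite: AbbesUllmo1996, Thm. A (p ∤ N ⟹ p ∤ c; here p = 2)] [cite: Jetchev2008, Thm. 1.4] [cite: GrossZagier1986, V.§2 (2.2)] -/
theorem bsdp_negDisc_of_wall_of_converse_of_tamagawaDivisibility_of_ndiv_of_abbesUllmo_of_facts
    (hGZ : ∀ (N : ℕ) [NeZero N] (W : WeierstrassCurve ℚ) (K : Type) [Field K] [NumberField K], gross_zagier N W K)
    (hGZK : rank_eq_analyticRank_of_analyticRank_le_one) (hmod : hasEntireLFunction_rat)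
    (hMilneC : Milne1972.bsdQuotient_baseChange_quadratic_anyModel)
    (hAU : abbesUllmo_not_dvd_maninConstant_of_not_dvd_level)
    (hS1 : ∀ (W : WeierstrassCurve ℚ) [W.IsElliptic] [W.IsGloballyMinimal],
      ¬ W.HasCM → W.analyticRank = 0 → Nat.card (W.selmerGroup 2) = 1 → BSDp W 2)
    (hC0 : ∀ (V : WeierstrassCurve ℚ) [V.IsElliptic] [V.IsGloballyMinimal], ¬ V.HasCM → V.selmerCorank 2 = 0 → V.analyticRank = 0)
    (hJ : TamagawaDivisibilityAtTwo)
    (hNDIV : ∀ (W : WeierstrassCurve ℚ) [W.IsElliptic] [W.IsGloballyMinimal] [NeZero (W.conductorNorm ℤ)],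
      ¬ W.HasCM → W.analyticRank = 1 → Nat.card (W.selmerGroup 2) = 2 → W.Δ < 0 → ¬ 2 ∣ W.conductorNorm ℤ →
      (∀ n : ℕ, 0 < n → W.HasSurjectiveModNGaloisRep ((2 : ℤ) ^ n)) →
      (∃ (q₀ : ℕ) (_ : Fact q₀.Prime), (q₀ : ℤ) ∣ W.conductorNorm ℤ ∧
        padicValNat 2 ((W.baseChange ℚ_[q₀]).localTamagawaNumber ℤ_[q₀]) = padicValNat 2 W.tamagawaProduct) →
      ∀ (K : Type) [Field K] [NumberField K], IsImaginaryQuadratic K →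
        ∀ (ℓ : ℕ) [Fact ℓ.Prime], NumberField.discr K = -(ℓ : ℤ) → ¬ W.selmerGroup 2 ≤ MazurRubin2010.strictLocalKer W ℚ_[ℓ] 2 →
        Odd (NumberField.discr K) → NumberField.discr K ≠ -3 → SatisfiesHeegnerHypothesis (W.conductorNorm ℤ) K →
        ((Ideal.span {(2 : ℤ)}).primesOver (𝓞 K)).ncard = 2 →
        (W.quadraticTwist (NumberField.discr K : ℚ)).entireLFunction 1 ≠ 0 →
        ∀ (Dt : ModularParametrizationData W (W.conductorNorm ℤ)),
          (∀ z ∈ Dt.L.lattice, ∃ w ∈ periodLattice Dt.f, z = (Dt.c : ℂ) * w) → Odd Dt.c →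
        ∀ (β : ℤ) (ι : K →+* ℂ) (d₁ : KolyvaginHeegnerData Dt β ι 1),
          ¬ ∃ Q : (W.baseChange (ringClassField K ι 1)).toAffine.Point,
            ((2 ^ (padicValNat 2 W.tamagawaProduct + 1) : ℕ) : ℤ) • Q = d₁.derivedPoint) :
    ∀ (W : WeierstrassCurve ℚ) [W.IsElliptic] [W.IsGloballyMinimal] [NeZero (W.conductorNorm ℤ)], ¬ W.HasCM → W.analyticRank = 1 →
      Nat.card (W.selmerGroup 2) = 2 → W.Δ < 0 → ¬ 2 ∣ W.conductorNorm ℤ →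
      (∀ n : ℕ, 0 < n → W.HasSurjectiveModNGaloisRep ((2 : ℤ) ^ n)) →
      (∃ Dt : ModularParametrizationData W (W.conductorNorm ℤ), ∀ z ∈ Dt.L.lattice, ∃ w ∈ periodLattice Dt.f, z = (Dt.c : ℂ) * w) →
      (∃ (q₀ : ℕ) (_ : Fact q₀.Prime), (q₀ : ℤ) ∣ W.conductorNorm ℤ ∧
        padicValNat 2 ((W.baseChange ℚ_[q₀]).localTamagawaNumber ℤ_[q₀]) = padicValNat 2 W.tamagawaProduct) →
      BSDp W 2 := by
  intro W _ _ _ hcm hr hSel hΔ hN hρ hopt hq₀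
  obtain ⟨Dt, hlat⟩ := hopt
  -- Abbes–Ullmo at `p = 2`, `2 ∤ N`: the optimal datum's Manin constant is odd
  have h2c : ¬ (2 : ℤ) ∣ Dt.c := by
    have h := hAU W Dt hlat 2 Nat.prime_two hN
    exact_mod_cast h
  have hc : Odd Dt.c := Int.not_even_iff_odd.mp fun he ↦ h2c (even_iff_two_dvd.mp he)
  exact bsdp_negDisc_of_wall_of_converse_of_tamagawaDivisibility_of_ndiv_of_facts hGZ hGZK hmod hMilneC hS1 hC0 hJ hNDIV W hcm hr hSel hΔ hN
    hρ ⟨Dt, hlat, hc⟩ hq₀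

end Summit.BirchSwinnertonDyer.BirchSwinnertonDyer.Theorems.GenusExact.TwinSwap.JetchevSplit

end
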